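import Literature.NumberTheory.Automorphic.AsaiSignCont
import Literature.NumberTheory.Automorphic.AsaiSignProofs
import Literature.NumberTheory.Automorphic.AutomorphicRepsGLSatakeFlathProofs
import Mathlib.RingTheory.DedekindDomain.Different
import Mathlib.NumberTheory.RamificationInertia.Unramified
import Mathlib.NumberTheory.RamificationInertia.Galois
import HarnessLib

/-!
# From the raw Asai pole to the continued Asai pole

Topic `NumberTheory/Automorphic`; namespace `Literature.NumberTheory.Automorphic`. Proof file
(theorems only; provefact unit `Mok2014_archimedean_parity_of_asaiSign`, 2026-08-16), joining the
accepted `AsaiSignCont` (continuation-form predicates `HasAsaiPoleCont`, `HasAsaiHolAtOneCont`,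
`HasAsaiSignCont` and the corrected named fact `Mok2014_partialAsaiL_continuation_pole_dichotomy`) to
the raw-to-continued bridge of the accepted `AsaiSignProofs`
(`AutomorphicRepData.HasAsaiPole.false_of_continuation`: a raw pole of `L^S(s, Π, As^η)` at `1⁺`
excludes every holomorphic continuation of `L^S(s, Π, As^η)` to `{1/2 < Re s}` — Baire, Cauchy
estimates, Weierstrass; no convergence hypothesis).

## What is proved

* `AutomorphicRepData.HasAsaiPole.not_hasAsaiHolAtOneCont` — unconditionally: a raw pole at sign `η`
  excludes "continued `L^S(s, Π, As^η)` holomorphic (and non-zero) at `1`", given one Asai datum.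
* `AutomorphicRepData.HasAsaiPole.hasAsaiPoleCont` — a raw pole at `η` plus the dichotomy FOR `π`
  (`HasAsaiPoleCont c η₀`, `HasAsaiHolAtOneCont c (-η₀)` for some `η₀`) gives the CONTINUED pole at the
  same sign `η` (so `η = η₀`); with the named fact: `CuspidalAutomorphicRepData.hasAsaiPoleCont_of_hasAsaiPole`,
  `….hasAsaiSignCont_of_hasAsaiSign`, and `….eq_of_hasAsaiPole_of_hasAsaiPoleCont` (the raw sign, when
  it exists, is Mok's sign). This is the direction RAW ⇒ CONTINUED with NO holomorphy hypothesis on the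
  raw products — the converse `HasAsaiPoleCont.hasAsaiPole_of_differentiableOn` (`AsaiSignCont`) keeps
  its `hhol`, rightly: a continued pole is a raw pole only if the raw product behaves on `{1 < Re s}`.
* `AutomorphicRepData.HasAsaiPole.exists_continuation_of_datum_dichotomy` — the accepted
  `HasAsaiPole.exists_continuation_of_dichotomy` (`WeaklyRegularGaloisRepOddContinuation`) without `hhol`.
* `Mok2014_archimedean_parity_of_asaiSign_of_hasAsaiSignCont` — the archimedean parity fact of
  `AsaiSign` follows from the corrected dichotomy (named fact) and its own CONTINUATION-currency form
  (hypothesis `HasAsaiSignCont c κ`, the printed "`L(s, Π, As^{(-1)^{N-1}κ})` has a pole at `s = 1`" of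
  Mok, Thm. 2.5.4 (a) / Cor. 2.5.5); cf. `Mok2014_archimedean_parity_of_asaiSign_of_continuation`
  (`AsaiSignProofs`), the same with the dichotomy spelled out.

Upshot for the record (`MokWeakBaseChange` "Discrepancy", `AsaiSign` module docstring): given Mok's
dichotomy in its corrected form, every statement with a raw `HasAsaiSign`/`HasAsaiPole` HYPOTHESIS is
implied by — weaker than — the same statement with the printed, continued-pole hypothesis.

## References

* C. P. Mok, *Endoscopic classification of representations of quasi-split unitary groups*,
  Mem. Amer. Math. Soc. 235 (2015), no. 1108 (arXiv:1206.0882): §2.5 and Thm. 2.5.4 (a) (p. 20),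
  Cor. 2.5.5 (p. 21), Thm. 2.4.10 (p. 16). [Mok2014]
* N. Grbac, F. Shahidi, *Endoscopic transfer for unitary groups and holomorphy of Asai
  `L`-functions*, Pacific J. Math. 276 (2015), §2.A and Thm. 4.3 (2). [GrbacShahidi2015]
-/

noncomputable section

open scoped Topology Classical MatrixGroups
open NumberField IsDedekindDomain Filter

namespace Literature.NumberTheory.Automorphic

section Reps

variable {F E : Type} [Field F] [NumberField F] [Field E] [NumberField E] [Algebra F E]
  {N : ℕ} {hcpt : isCompact_glFiniteIntegralLevel N E}
  {π : AutomorphicRepData (AutomorphyDatum.gl N E hcpt)} {c : E ≃ₐ[F] E} {η : ℤˣ}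

/-- **A raw pole at sign `η` excludes holomorphy at `1` of the continued `L^S(s, Π, As^η)`**, given one
Asai datum — unconditionally (`HasAsaiPole.false_of_continuation`; no dichotomy, no holomorphy of the
raw product). [folklore] -/
theorem AutomorphicRepData.HasAsaiPole.not_hasAsaiHolAtOneCont (hpole : π.HasAsaiPole c η)
    {S : Set (HeightOneSpectrum (𝓞 F))} {A : SatakeFamily E} (hSA : π.IsAsaiDatum c S A) :
    ¬ π.HasAsaiHolAtOneCont c η := by
  intro hh
  obtain ⟨σ₀, -, -, H, hH, hHL, -⟩ := hh hSA
  exact hpole.false_of_continuation hSA hH hHL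

/-- **Raw pole ⇒ continued pole, given the dichotomy for `π`.** If `π.HasAsaiPole c η` (raw) and
some sign `η₀` has `HasAsaiPoleCont c η₀` and `HasAsaiHolAtOneCont c (-η₀)` (Mok's dichotomy for `π`
in continuation form, e.g. from `CuspidalAutomorphicRepData.exists_hasAsaiPoleCont`), then
`π.HasAsaiPoleCont c η`: datum by datum, `η = -η₀` is excluded by `not_hasAsaiHolAtOneCont`, so
`η = η₀`. [cite: Mok2014, §2.5 and Thm. 2.5.4 (a)] -/
theorem AutomorphicRepData.HasAsaiPole.hasAsaiPoleCont (hpole : π.HasAsaiPole c η) {η₀ : ℤˣ}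
    (hp : π.HasAsaiPoleCont c η₀) (hh : π.HasAsaiHolAtOneCont c (-η₀)) : π.HasAsaiPoleCont c η := by
  intro S A hSA
  by_cases hηη₀ : η = η₀
  · subst hηη₀
    exact hp hSA
  · have hneg : -η₀ = η := (Int.units_ne_iff_eq_neg.mp hηη₀).symm
    rw [hneg] at hh
    exact ((hpole.not_hasAsaiHolAtOneCont hSA) hh).elim

/-- **The continued pole at the raw sign, granted the dichotomy for one datum** — the accepted
`HasAsaiPole.exists_continuation_of_dichotomy` (`WeaklyRegularGaloisRepOddContinuation`) with its
holomorphy hypothesis `hhol` on the raw product removed: if `π.HasAsaiPole c η`, `(S, A)` is an Asai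
datum and the datum satisfies the dichotomy (some `η₀`, `σ₀ ≥ 1`, both products multipliable on
`Re s > σ₀`, `G` continuing `(s - 1) L^S(s, Π, As^{η₀})` with `G(1) ≠ 0`, `H` continuing
`L^S(s, Π, As^{-η₀})`, both holomorphic on `{1/2 < Re s}`), then `η₀ = η` and the continued
`L^S(s, Π, As^η)` has the simple pole. [folklore] -/
theorem AutomorphicRepData.HasAsaiPole.exists_continuation_of_datum_dichotomy
    (hpole : π.HasAsaiPole c η) {S : Set (HeightOneSpectrum (𝓞 F))} {A : SatakeFamily E}
    (hSA : π.IsAsaiDatum c S A)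
    (hdich : ∃ (η₀ : ℤˣ) (σ₀ : ℝ), 1 ≤ σ₀ ∧
      (∀ (θ : ℤˣ) (s : ℂ), σ₀ < s.re →
        Multipliable fun v : {v : HeightOneSpectrum (𝓞 F) // v ∉ S} =>
          ((asaiLocalPolynomial c A θ (placeAbove E v.1)).eval ((v.1.residueCard : ℂ) ^ (-s)))⁻¹) ∧
      (∃ G : ℂ → ℂ, DifferentiableOn ℂ G {s : ℂ | 1 / 2 < s.re} ∧
        (∀ s : ℂ, σ₀ < s.re → G s = (s - 1) * partialAsaiL S c A η₀ s) ∧ G 1 ≠ 0) ∧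
      (∃ H : ℂ → ℂ, DifferentiableOn ℂ H {s : ℂ | 1 / 2 < s.re} ∧
        (∀ s : ℂ, σ₀ < s.re → H s = partialAsaiL S c A (-η₀) s))) :
    ∃ σ₀ : ℝ, 1 ≤ σ₀ ∧
      (∀ s : ℂ, σ₀ < s.re →
        Multipliable fun v : {v : HeightOneSpectrum (𝓞 F) // v ∉ S} =>
          ((asaiLocalPolynomial c A η (placeAbove E v.1)).eval ((v.1.residueCard : ℂ) ^ (-s)))⁻¹) ∧
      ∃ G : ℂ → ℂ, DifferentiableOn ℂ G {s : ℂ | 1 / 2 < s.re} ∧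
        (∀ s : ℂ, σ₀ < s.re → G s = (s - 1) * partialAsaiL S c A η s) ∧ G 1 ≠ 0 := by
  obtain ⟨η₀, σ₀, hσ₀, hmult, ⟨G, hG, hGL, hG1⟩, ⟨H, hH, hHL⟩⟩ := hdich
  by_cases hη : η₀ = η
  · subst hη
    exact ⟨σ₀, hσ₀, fun s hs => hmult _ s hs, G, hG, hGL, hG1⟩
  · have hneg : -η₀ = η := by rw [Int.units_ne_iff_eq_neg.mp hη, neg_neg]
    exact (hpole.false_of_continuation hSA hH (fun s hs => by rw [hHL s hs, hneg])).elim

variable (c) in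
/-- **For a conjugate self-dual cuspidal `Π`, a raw Asai pole is a continued Asai pole at the same
sign** (given Mok's dichotomy `Mok2014_partialAsaiL_continuation_pole_dichotomy`, no holomorphy
hypothesis on the raw products). [cite: Mok2014, §2.5 and Thm. 2.5.4 (a)] -/
theorem CuspidalAutomorphicRepData.hasAsaiPoleCont_of_hasAsaiPole
    (hMok : Mok2014_partialAsaiL_continuation_pole_dichotomy) (h2 : Module.finrank F E = 2)
    (hc : c ≠ 1) (hN : 0 < N) (π : CuspidalAutomorphicRepData N E hcpt)
    (hπ : π.1.IsConjSelfDualAE c) {η : ℤˣ} (hpole : π.1.HasAsaiPole c η) :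
    π.1.HasAsaiPoleCont c η := by
  obtain ⟨η₀, hp, hh⟩ := π.exists_hasAsaiPoleCont hMok h2 hc hN hπ
  exact hpole.hasAsaiPoleCont hp hh

variable (c) in
/-- **A raw Asai sign is a continued Asai sign**: `HasAsaiSign c κ → HasAsaiSignCont c κ` for a
conjugate self-dual cuspidal `Π` (given the dichotomy). [cite: Mok2014, Thm. 2.5.4 (a)] -/
theorem CuspidalAutomorphicRepData.hasAsaiSignCont_of_hasAsaiSign
    (hMok : Mok2014_partialAsaiL_continuation_pole_dichotomy) (h2 : Module.finrank F E = 2)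
    (hc : c ≠ 1) (hN : 0 < N) (π : CuspidalAutomorphicRepData N E hcpt)
    (hπ : π.1.IsConjSelfDualAE c) {κ : ℤˣ} (h : π.1.HasAsaiSign c κ) :
    π.1.HasAsaiSignCont c κ :=
  π.hasAsaiPoleCont_of_hasAsaiPole c hMok h2 hc hN hπ h

variable (c) in
/-- **The raw pole sign, when it exists, is Mok's sign**: if `L^S(s, Π, As^η)` has a raw pole and
`L^S(s, Π, As^{η'})` the continued pole, then `η = η'` (given the dichotomy and one Asai datum;
`hasAsaiPoleCont_unique`). [cite: Mok2014, §2.5 before Thm. 2.5.4] -/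
theorem CuspidalAutomorphicRepData.eq_of_hasAsaiPole_of_hasAsaiPoleCont
    (hMok : Mok2014_partialAsaiL_continuation_pole_dichotomy) (h2 : Module.finrank F E = 2)
    (hc : c ≠ 1) (hN : 0 < N) (π : CuspidalAutomorphicRepData N E hcpt)
    (hπ : π.1.IsConjSelfDualAE c) {S : Set (HeightOneSpectrum (𝓞 F))} {A : SatakeFamily E}
    (hSA : π.1.IsAsaiDatum c S A) {η η' : ℤˣ} (hη : π.1.HasAsaiPole c η)
    (hη' : π.1.HasAsaiPoleCont c η') : η = η' :=
  π.hasAsaiPoleCont_unique hMok h2 hc hN hπ hSA (π.hasAsaiPoleCont_of_hasAsaiPole c hMok h2 hc hN hπ hη)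
    hη'

end Reps

/-- **`Mok2014_archimedean_parity_of_asaiSign` from the corrected dichotomy and its
continuation-currency form.** Hypotheses: the named fact `Mok2014_partialAsaiL_continuation_pole_dichotomy`
(`AsaiSignCont`: Mok, §2.5 and Thm. 2.5.4 (a); Grbac–Shahidi 2015, Thm. 4.3 (2)), and `hcont`, the fact
`Mok2014_archimedean_parity_of_asaiSign` (`AsaiSign`) with its raw hypothesis `HasAsaiSign c κ` replaced
by the continuation-form `HasAsaiSignCont c κ` — the printed hypothesis of Mok, Thm. 2.5.4 (a) /
Cor. 2.5.5 ("`L(s, Π, As^{(-1)^{N-1}})` has a pole at `s = 1`" for the continued Langlands–Shahidi Asai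
`L`-function), whose proof is Mok's second seed theorem 2.4.10 with Lemma 2.2.1, Remark 2.2.2 and
(2.2.6) (arXiv pp. 16, 21) — the part that remains to be vendored. Proof: a raw sign is a continued sign
(`CuspidalAutomorphicRepData.hasAsaiSignCont_of_hasAsaiSign`).
[cite: Mok2014, Thm. 2.5.4 (a), Cor. 2.5.5 (arXiv pp. 20–21) and Thm. 2.4.10 (p. 16)] -/
theorem Mok2014_archimedean_parity_of_asaiSign_of_hasAsaiSignCont
    (hMok : Mok2014_partialAsaiL_continuation_pole_dichotomy)
    (hcont : ∀ (F E : Type) [Field F] [NumberField F] [Field E] [NumberField E] [Algebra F E]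
        (c : E ≃ₐ[F] E), Module.finrank F E = 2 → c ≠ 1 →
        ∀ (N : ℕ) (hcpt : isCompact_glFiniteIntegralLevel N E)
          (P : CuspidalAutomorphicRepData N E hcpt) (κ : ℤˣ) (χ : (E →+* ℂ) → Multiset ℂ)
          (σ : E →+* ℂ) (r : ℝ), 0 < N → P.1.IsConjSelfDualAE c → P.1.HasAsaiSignCont c κ →
          P.1.HasArchParameter χ → NumberField.ComplexEmbedding.IsConj σ c → (χ σ).Nodup →
          (∀ a ∈ χ σ, ∃ m : ℤ, a = (m : ℂ) + (r : ℂ)) →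
          ∀ a ∈ χ σ, ∃ m : ℤ, a = (m : ℂ) + ((N : ℂ) - 1) / 2 + (1 - ((κ : ℤ) : ℂ)) / 4) :
    Mok2014_archimedean_parity_of_asaiSign := by
  intro F E _ _ _ _ _ c h2 hc N hcpt P κ χ σ r hN hcsd hsign hχ hσ hnd hcoset
  exact hcont F E c h2 hc N hcpt P κ χ σ r hN hcsd
    (P.hasAsaiSignCont_of_hasAsaiSign c hMok h2 hc hN hcsd hsign) hχ hσ hnd hcoset


/-! ### Appended 2026-08-16 (provefact unit `Mok2014_archimedean_parity_of_asaiSign`, session 4)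

Two things.

**(1) Asai data exist** (`AutomorphicRepData.exists_isAsaiDatum`), for every automorphic
representation datum `π` of `GL_N(𝔸_E)` and every quadratic `E/F` with non-trivial automorphism
`c`: take for `S` the (finite) set of places of `F` below a place of `E` where `π` is ramified
(Flath: `π` is unramified almost everywhere, the PROVED `hasSatakeParamAt_cofinite_holds`) or where
`E/F` is ramified (finitely many: the prime divisors of the non-zero relative different, Dedekind's
different theorem), and for `A` any choice of Satake parameters; at a `c`-fixed place `w` above
`v ∉ S` one has `#{w | v} = 1`, `e(w|v) = 1`, hence `f(w|v) = 2` by the fundamental identity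
(`HeightOneSpectrum.inertiaDeg_eq_two_of_smul_eq`).  The predicates `HasAsaiPole`, `HasAsaiSign`,
`HasAsaiPoleCont`, `HasAsaiSignCont`, `HasAsaiHolAtOneCont` all quantify over ALL Asai data of `π`, so
without (1) they could hold vacuously for both signs; with (1) the "given one Asai datum" hypotheses of
the uniqueness statements of `AsaiSign` / `AsaiSignCont` / this file can be dropped
(`HasAsaiPole.not_hasAsaiHolAtOneCont'` — unconditional —, and, under the dichotomy,
`CuspidalAutomorphicRepData.hasAsaiSign_unique_of_continuation_dichotomy`,
`….hasAsaiSignCont_iff_eq_of_hasAsaiSign`: on a representation carrying a raw Asai sign `κ` the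
continued sign is `κ` and no other).

**(2) The raw-currency fact from the two NAMED facts of `AsaiSignCont`.**  Since
`Mok2014_archimedean_parity_of_asaiSign_of_hasAsaiSignCont` (above) was landed, the
continuation-currency form of the archimedean sign pin has been vendored as the named fact
`Mok2014_archimedean_parity_of_asaiSignCont` (`AsaiSignCont`, appended 2026-08-16 for the line
`one-transparent-pane` of the crux `QuadraticWindow.HostInducedRep`); its statement is VERBATIM the
binder `hcont` above.  `Mok2014_archimedean_parity_of_asaiSign_of_facts` records the resulting
dependency of the raw-currency fact `Mok2014_archimedean_parity_of_asaiSign` (`AsaiSign`) on EXISTING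
named facts only — it is the conjunction-consequence of
* `Mok2014_partialAsaiL_continuation_pole_dichotomy` (Mok, §2.5 and Thm. 2.5.4 (a); Grbac–Shahidi
  2015, Thm. 4.3 (2): continuation and pole dichotomy of the partial Asai `L`-functions of a conjugate
  self-dual cuspidal `Π`) — used only to convert the raw pole of the hypothesis `HasAsaiSign c κ` into
  the continued pole `HasAsaiSignCont c κ` at the SAME sign, and
* `Mok2014_archimedean_parity_of_asaiSignCont` (Mok, Thm. 2.4.10 with Lemma 2.2.1, Remark 2.2.2,
  (2.2.6) and Cor. 2.5.5: the continued Asai sign `κ` pins the coset of the exponents at a `c`-fixed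
  complex place) —
so that `Mok2014_archimedean_parity_of_asaiSign_holds` is the term
`Mok2014_archimedean_parity_of_asaiSign_of_facts ‹…›_holds ‹…›_holds` as soon as both discharges
exist; neither does today (both rest on Mok's endoscopic classification, the second on the "second seed
theorem" 2.4.10, arXiv p. 16: "the complete proof is achieved only in section nine").

Additional references for (1): D. Flath, *Decomposition of representations into tensor products*,
Corvallis (1979), Thm. 3; J. Neukirch, *Algebraic Number Theory* (1999), Ch. I (8.2)/(9.2) (fundamental
identity) and Ch. III Thm. (2.6) (Dedekind's different theorem); Y. Flicker, *Twisted tensors and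
Euler products*, Bull. SMF 116 (1988), pp. 295–296 (the finite set `V` of an Asai Euler product).
-/

section AsaiData

variable {F E : Type} [Field F] [NumberField F] [Field E] [NumberField E] [Algebra F E]

/-- **`c`-fixed places unramified in `E/F` are inert: `f(w|v) = 2`.**  In a quadratic extension
`E/F` with non-trivial automorphism `c`, if `c • w = w` then `w` is the only place above
`v = w ∩ 𝓞 F` (the fibre is one `{1, c}`-orbit, `HeightOneSpectrum.eq_or_eq_smul_of_under_eq`), so
the fundamental identity `#{w | v} · e_v · f_v = [E : F] = 2` (Galois case, Mathlib
`Ideal.ncard_primesOver_mul_ramificationIdxIn_mul_inertiaDegIn` through the accepted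
`card_placesOver_mul_inertiaDegIn`) gives `f(w|v) = 2` as soon as `e(w|v) = 1`.  Companion of the
accepted `HeightOneSpectrum.inertiaDeg_eq_one_of_smul_ne` (`f = 1` at places moved by `c`).
Neukirch, *Algebraic Number Theory*, Ch. I, (9.2). [folklore] -/
theorem HeightOneSpectrum.inertiaDeg_eq_two_of_smul_eq (h2 : Module.finrank F E = 2)
    {c : E ≃ₐ[F] E} (hc : c ≠ 1) {w : HeightOneSpectrum (𝓞 E)} (hw : c • w = w)
    (he : w.asIdeal.ramificationIdx (𝓞 F) = 1) : w.asIdeal.inertiaDeg (𝓞 F) = 2 := by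
  haveI : Algebra.IsQuadraticExtension F E := { finrank_eq_two' := h2 }
  haveI := finite_placesOver (E := E) (w.under (𝓞 F))
  -- the fibre above `v = w ∩ 𝓞 F` is `{w}`
  have hcard : Nat.card {w' : HeightOneSpectrum (𝓞 E) // w'.under (𝓞 F) = w.under (𝓞 F)} = 1 := by
    rw [Nat.card_eq_one_iff_unique]
    refine ⟨⟨fun a b => Subtype.ext ?_⟩, ⟨⟨w, rfl⟩⟩⟩
    have ha : a.1 = w := by
      rcases HeightOneSpectrum.eq_or_eq_smul_of_under_eq h2 hc a.2 with h | h
      · exact h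
      · rw [h, hw]
    have hb : b.1 = w := by
      rcases HeightOneSpectrum.eq_or_eq_smul_of_under_eq h2 hc b.2 with h | h
      · exact h
      · rw [h, hw]
    rw [ha, hb]
  -- `e_v = e(w|v) = 1` (Galois: all ramification indices above `v` agree)
  have hev : (w.under (𝓞 F)).asIdeal.ramificationIdxIn (𝓞 E) = 1 := by
    haveI : w.asIdeal.LiesOver (w.under (𝓞 F)).asIdeal := ⟨rfl⟩
    rw [Ideal.ramificationIdxIn_eq_ramificationIdx (w.under (𝓞 F)).asIdeal w.asIdeal (E ≃ₐ[F] E)]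
    exact he
  have hfund := card_placesOver_mul_inertiaDegIn (E := E) (w.under (𝓞 F)) hev
  rw [hcard, one_mul, h2] at hfund
  rw [inertiaDeg_eq_inertiaDegIn_under w, hfund]

/-- **`E/F` is unramified at all but finitely many places** — a private copy, to keep the imports
of this file light, of the accepted `eventually_ramificationIdx_eq_one` of `Sweep1BaseChangeGLOne`
(same proof: the ramified primes divide the non-zero relative different, Mathlib
`not_dvd_differentIdeal_iff`, `Ideal.finite_factors`). Neukirch, Ch. III, Thm. (2.6). [folklore] -/
private theorem eventually_ramificationIdx_eq_one_aux :
    ∀ᶠ w : HeightOneSpectrum (𝓞 E) in cofinite, w.asIdeal.ramificationIdx (𝓞 F) = 1 := by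
  have h0 : differentIdeal (𝓞 F) (𝓞 E) ≠ ⊥ := differentIdeal_ne_bot
  refine (Ideal.finite_factors h0).subset fun w hw => ?_
  by_contra hnd
  apply hw
  haveI : Algebra.IsUnramifiedAt (𝓞 F) w.asIdeal := not_dvd_differentIdeal_iff.mp hnd
  exact Ideal.ramificationIdx_eq_one_of_isUnramifiedAt

namespace AutomorphicRepData

variable {N : ℕ} {hcpt : isCompact_glFiniteIntegralLevel N E}

/-- **Asai data exist** for every automorphic representation datum `π` of `GL_N(𝔸_E)` (`[E : F] = 2`,
`c ≠ 1`): `S :=` the places of `F` below the finitely many places of `E` where `π` is ramified (Flath,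
Thm. 3: `hasSatakeParamAt_cofinite_holds`) or `E/F` is ramified (Dedekind), `A :=` a choice of Satake
parameters.  This is Flicker's "finite set `V` … including the places where `E/F` ramify … such that
for each place `v'` of `E` above a place `v` outside `V` the component `π_{v'}` is unramified".
[cite: Flicker1988, pp. 295–296] [cite: FlathCorvallis1979, Thm. 3] -/
theorem exists_isAsaiDatum (h2 : Module.finrank F E = 2) {c : E ≃ₐ[F] E} (hc : c ≠ 1)
    (π : AutomorphicRepData (AutomorphyDatum.gl N E hcpt)) :
    ∃ (S : Set (HeightOneSpectrum (𝓞 F))) (A : SatakeFamily E), π.IsAsaiDatum c S A := by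
  classical
  set T : Set (HeightOneSpectrum (𝓞 E)) :=
    {w | ¬ π.IsUnramifiedAt w} ∪ {w | w.asIdeal.ramificationIdx (𝓞 F) ≠ 1} with hT
  have hT₁ : {w : HeightOneSpectrum (𝓞 E) | ¬ π.IsUnramifiedAt w}.Finite :=
    Filter.eventually_cofinite.mp π.hasSatakeParamAt_cofinite_holds
  have hT₂ : {w : HeightOneSpectrum (𝓞 E) | w.asIdeal.ramificationIdx (𝓞 F) ≠ 1}.Finite :=
    Filter.eventually_cofinite.mp eventually_ramificationIdx_eq_one_aux
  have hTfin : T.Finite := hT₁.union hT₂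
  refine ⟨(fun w : HeightOneSpectrum (𝓞 E) => w.under (𝓞 F)) '' T,
    fun w => if h : π.IsUnramifiedAt w then h.choose else 0, hTfin.image _, ?_, ?_⟩
  · intro w hw
    have hwT : w ∉ T := fun h => hw ⟨w, h, rfl⟩
    have hunr : π.IsUnramifiedAt w := by
      by_contra h
      exact hwT (Or.inl h)
    simp only [dif_pos hunr]
    exact hunr.choose_spec
  · intro w hw hcw
    have hwT : w ∉ T := fun h => hw ⟨w, h, rfl⟩
    have he : w.asIdeal.ramificationIdx (𝓞 F) = 1 := by
      by_contra h
      exact hwT (Or.inr h)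
    exact HeightOneSpectrum.inertiaDeg_eq_two_of_smul_eq h2 hc hcw he

/-- **A raw pole at sign `η` excludes holomorphy at `1` of the continued `L^S(s, Π, As^η)`** —
datum-free form of `HasAsaiPole.not_hasAsaiHolAtOneCont` (an Asai datum exists,
`exists_isAsaiDatum`); unconditional. [folklore] -/
theorem HasAsaiPole.not_hasAsaiHolAtOneCont' (h2 : Module.finrank F E = 2) {c : E ≃ₐ[F] E}
    (hc : c ≠ 1) {π : AutomorphicRepData (AutomorphyDatum.gl N E hcpt)} {η : ℤˣ}
    (hpole : π.HasAsaiPole c η) : ¬ π.HasAsaiHolAtOneCont c η := by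
  obtain ⟨S, A, hSA⟩ := π.exists_isAsaiDatum h2 hc
  exact hpole.not_hasAsaiHolAtOneCont hSA

/-- **Continued pole signs are unique, datum-free**: under the dichotomy, a conjugate self-dual
cuspidal `Π` (`N ≥ 1`) has `HasAsaiPoleCont c η` for at most one `η`
(`CuspidalAutomorphicRepData.hasAsaiPoleCont_unique` with the datum supplied by `exists_isAsaiDatum`).
[cite: Mok2014, §2.5 (paragraph before Thm. 2.5.4)] -/
theorem _root_.Literature.NumberTheory.Automorphic.CuspidalAutomorphicRepData.hasAsaiPoleCont_unique'
    {c : E ≃ₐ[F] E} (hMok : Mok2014_partialAsaiL_continuation_pole_dichotomy)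
    (h2 : Module.finrank F E = 2) (hc : c ≠ 1) (hN : 0 < N) (π : CuspidalAutomorphicRepData N E hcpt)
    (hπ : π.1.IsConjSelfDualAE c) {η η' : ℤˣ} (hη : π.1.HasAsaiPoleCont c η)
    (hη' : π.1.HasAsaiPoleCont c η') : η = η' := by
  obtain ⟨S, A, hSA⟩ := π.1.exists_isAsaiDatum h2 hc
  exact π.hasAsaiPoleCont_unique hMok h2 hc hN hπ hSA hη hη'

end AutomorphicRepData

variable {N : ℕ} {hcpt : isCompact_glFiniteIntegralLevel N E} {c : E ≃ₐ[F] E}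

/-- **The raw Asai sign, when it exists, is unique** (datum-free): under the dichotomy, for a
conjugate self-dual cuspidal `Π`, `N ≥ 1`, `HasAsaiSign c κ → HasAsaiSign c κ' → κ = κ'` — both raw
signs are continued signs (`hasAsaiSignCont_of_hasAsaiSign`), and those are unique.
[cite: Mok2014, §2.5 and Thm. 2.5.4 (a)] -/
theorem CuspidalAutomorphicRepData.hasAsaiSign_unique_of_continuation_dichotomy
    (hMok : Mok2014_partialAsaiL_continuation_pole_dichotomy) (h2 : Module.finrank F E = 2)
    (hc : c ≠ 1) (hN : 0 < N) (π : CuspidalAutomorphicRepData N E hcpt)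
    (hπ : π.1.IsConjSelfDualAE c) {κ κ' : ℤˣ} (hκ : π.1.HasAsaiSign c κ)
    (hκ' : π.1.HasAsaiSign c κ') : κ = κ' := by
  have h := π.hasAsaiPoleCont_unique' hMok h2 hc hN hπ
    (π.hasAsaiSignCont_of_hasAsaiSign c hMok h2 hc hN hπ hκ)
    (π.hasAsaiSignCont_of_hasAsaiSign c hMok h2 hc hN hπ hκ')
  exact mul_left_cancel h

/-- **The two currencies of the Asai sign agree wherever a raw sign exists**: under the dichotomy,
for a conjugate self-dual cuspidal `Π` (`N ≥ 1`) with a raw sign `κ` (`HasAsaiSign c κ`) one has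
`HasAsaiSignCont c κ' ↔ κ' = κ`.  So on such `Π` the hypotheses of `Mok2014_archimedean_parity_of_asaiSign`
and of `Mok2014_archimedean_parity_of_asaiSignCont` single out the same sign.
[cite: Mok2014, §2.5 (paragraph before Thm. 2.5.4) and Thm. 2.5.4 (a)] -/
theorem CuspidalAutomorphicRepData.hasAsaiSignCont_iff_eq_of_hasAsaiSign
    (hMok : Mok2014_partialAsaiL_continuation_pole_dichotomy) (h2 : Module.finrank F E = 2)
    (hc : c ≠ 1) (hN : 0 < N) (π : CuspidalAutomorphicRepData N E hcpt)
    (hπ : π.1.IsConjSelfDualAE c) {κ : ℤˣ} (hκ : π.1.HasAsaiSign c κ) (κ' : ℤˣ) :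
    π.1.HasAsaiSignCont c κ' ↔ κ' = κ := by
  constructor
  · intro hκ'
    have h := π.hasAsaiPoleCont_unique' hMok h2 hc hN hπ hκ'
      (π.hasAsaiSignCont_of_hasAsaiSign c hMok h2 hc hN hπ hκ)
    exact mul_left_cancel h
  · rintro rfl
    exact π.hasAsaiSignCont_of_hasAsaiSign c hMok h2 hc hN hπ hκ

end AsaiData

/-- **`Mok2014_archimedean_parity_of_asaiSign` (raw Asai-sign currency) follows from the two named
facts `Mok2014_partialAsaiL_continuation_pole_dichotomy` and
`Mok2014_archimedean_parity_of_asaiSignCont` (continuation currency).**  Printed sources of the two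
inputs: Mok, §2.5 (paragraph before Thm. 2.5.4) and Thm. 2.5.4 (a) — "exactly one of the functions
`L(s, φ^N, As^±)` has a pole at `s = 1`, which is a simple pole", "the Asai `L`-function
`L(s, φ^N, As^η)` has a pole at `s = 1`, where `η = (-1)^{N-1} κ`" (arXiv p. 20) —, and Thm. 2.4.10,
Lemma 2.2.1, Remark 2.2.2, (2.2.6), Cor. 2.5.5 (arXiv pp. 8, 16, 21).  Proof: the theorem
`Mok2014_archimedean_parity_of_asaiSign_of_hasAsaiSignCont` with `hcont :=` the second fact
(definitionally its binder): a raw sign is a continued sign at the same sign.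
[cite: Mok2014, §2.5 and Thm. 2.5.4 (a) (arXiv p. 20); Thm. 2.4.10 (p. 16), Lemma 2.2.1 and Remark 2.2.2 (p. 8), Cor. 2.5.5 (p. 21)]
[cite: GrbacShahidi2015, Thm. 4.3 (2)] -/
theorem Mok2014_archimedean_parity_of_asaiSign_of_facts
    (hMok : Mok2014_partialAsaiL_continuation_pole_dichotomy)
    (hcont : Mok2014_archimedean_parity_of_asaiSignCont) :
    Mok2014_archimedean_parity_of_asaiSign :=
  Mok2014_archimedean_parity_of_asaiSign_of_hasAsaiSignCont hMok hcont

end Literature.NumberTheory.Automorphic
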